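import Summits.QuantumFields.YangMills.Theorems.AllWindowsColdBoxBoxHighLineHodgePoincareBoxSums

/-!
# LINE-19 stub S1 `HodgePoincareColdBox` (crux `AllWindowsColdBox.BoxHighWindowsSU22`, stmt-QuantumFields-24004 / low item 24335),
# part 2: the lattice div–curl identity on `ℤ⁴` and the energy of CORE edge functions

For a real edge function `u : ℤ⁴ × Fin 4 → ℝ` supported on edges based in the cube `[0,N]⁴`:
* `sum_cross_eq` — lattice summation by parts (the cross term of the div–curl identity):
  `Σ_z (∇_i u_j)(z)·(∇_j u_i)(z) = Σ_x D_i(x)·D_j(x)` with forward differences `∇` and backward differences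
  `D_i(x) = u(x,i) − u(x−e_i,i)`, all sums over the cube `[-2,N+2]⁴` (three translation reindexings);
* `cross_eq_zero_of_not_interior` — for a CORE edge function (every transverse coordinate of a charged edge in `[1,N−1]`)
  the products `D_i(x)·D_j(x)`, `i ≠ j`, vanish off the interior cube `[1,N−1]⁴` (at a non-interior site at most one backward
  difference is non-zero);
* `core_energy` — consequently the Maxwell-plus-gauge form of a core edge function dominates all its transverse Dirichlet
  energies: `Σ_{i≠j} ‖∇_i u_j‖² ≤ Σ_{plaquettes} circ² + Σ_{interior} div²` (the tensor-product / relative-boundary-condition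
  Hodge identity, with the non-negative interior diagonal `Σ_interior Σ_i D_i²` dropped).
Mathlib only (via part 1).  HONEST LABEL: helper toward ONE registered stub of a critic-PASSed line; no crux, rung or summit
is proved; the Yang–Mills mass gap is NOT proved by this file.
-/

set_option autoImplicit false

open Finset

namespace Summit.QuantumFields.YangMills.Theorems.AllWindowsColdBoxBoxHighLine.HodgePoincare

/-! ## Part 2: the lattice div–curl identity and the energy of CORE edge functions -/

/-- Coordinates of a unit vector `e_i` lie in `{0, 1}`. -/
theorem single_one_apply_bounds (i k : Fin 4) :
    0 ≤ (Pi.single i (1 : ℤ) : Fin 4 → ℤ) k ∧ (Pi.single i (1 : ℤ) : Fin 4 → ℤ) k ≤ 1 := by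
  by_cases h : k = i
  · subst h; simp
  · simp [Pi.single_eq_of_ne h]

/-- For `i ≠ j` the coordinates of `e_i + e_j` lie in `{0, 1}`. -/
theorem single_add_single_apply_bounds {i j : Fin 4} (hij : i ≠ j) (k : Fin 4) :
    0 ≤ (Pi.single i (1 : ℤ) + Pi.single j (1 : ℤ) : Fin 4 → ℤ) k ∧
      (Pi.single i (1 : ℤ) + Pi.single j (1 : ℤ) : Fin 4 → ℤ) k ≤ 1 := by
  rw [Pi.add_apply]
  by_cases hi : k = i
  · subst hi
    rw [Pi.single_eq_same, Pi.single_eq_of_ne hij]; simp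
  · rw [Pi.single_eq_of_ne hi, zero_add]
    exact single_one_apply_bounds j k

/-- Support bookkeeping: if `u` is supported on edges based in `[0,N]⁴` and `u (x + w, i) ≠ 0` for a vector `w` with
coordinates in `[-1, 1]`, then `x ∈ [-1, N+1]⁴`. -/
theorem bounds_of_shift_ne_zero {N : ℕ} {u : (Fin 4 → ℤ) × Fin 4 → ℝ}
    (hsupp : ∀ x i, u (x, i) ≠ 0 → ∀ k, 0 ≤ x k ∧ x k ≤ N) {x w : Fin 4 → ℤ} {i : Fin 4}
    (hw : ∀ k, -1 ≤ w k ∧ w k ≤ 1) (h : u (x + w, i) ≠ 0) : ∀ k, -1 ≤ x k ∧ x k ≤ N + 1 := by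
  intro k
  have h1 := hsupp _ _ h k
  have h2 := hw k
  simp only [Pi.add_apply] at h1
  constructor <;> omega

/-- **Lattice summation by parts (the cross term of the div–curl identity).**  For an edge function supported on edges
based in `[0,N]⁴` and `i ≠ j`,
`Σ_z (u(z+e_i, j) − u(z, j))·(u(z+e_j, i) − u(z, i)) = Σ_x (u(x, i) − u(x−e_i, i))·(u(x, j) − u(x−e_j, j))`,
both sums over the cube `[-2, N+2]⁴` (which contains all non-zero terms). -/
theorem sum_cross_eq (N : ℕ) (u : (Fin 4 → ℤ) × Fin 4 → ℝ)
    (hsupp : ∀ x i, u (x, i) ≠ 0 → ∀ k, 0 ≤ x k ∧ x k ≤ N) {i j : Fin 4} (hij : i ≠ j) :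
    ∑ z ∈ Fintype.piFinset (fun _ : Fin 4 => Finset.Icc (-2 : ℤ) (N + 2)),
        (u (z + Pi.single i 1, j) - u (z, j)) * (u (z + Pi.single j 1, i) - u (z, i)) =
      ∑ x ∈ Fintype.piFinset (fun _ : Fin 4 => Finset.Icc (-2 : ℤ) (N + 2)),
        (u (x, i) - u (x - Pi.single i 1, i)) * (u (x, j) - u (x - Pi.single j 1, j)) := by
  have hei := single_one_apply_bounds i
  have hej := single_one_apply_bounds j
  -- the four products on the right and their translates on the left
  have T1 : ∑ z ∈ Fintype.piFinset (fun _ : Fin 4 => Finset.Icc (-2 : ℤ) (N + 2)),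
      u (z + Pi.single i 1, j) * u (z + Pi.single j 1, i) =
      ∑ x ∈ Fintype.piFinset (fun _ : Fin 4 => Finset.Icc (-2 : ℤ) (N + 2)),
      u (x - Pi.single j 1, j) * u (x - Pi.single i 1, i) := by
    have key := sum_shift_eq (a := -2) (b := (N : ℤ) + 2) (Pi.single i 1 + Pi.single j 1)
      (fun x => u (x - Pi.single j 1, j) * u (x - Pi.single i 1, i)) ?_
    · refine Eq.trans (Finset.sum_congr rfl fun z _ => ?_) key
      have h1 : z + (Pi.single i 1 + Pi.single j 1) - Pi.single j 1 = z + Pi.single i 1 := by abel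
      have h2 : z + (Pi.single i 1 + Pi.single j 1) - Pi.single i 1 = z + Pi.single j 1 := by abel
      simp only [h1, h2]
    · intro x hx
      obtain ⟨ha, hb⟩ := mul_ne_zero_iff.1 hx
      have hb' : u (x + (-Pi.single i 1), i) ≠ 0 := by rwa [← sub_eq_add_neg]
      have hbx := bounds_of_shift_ne_zero hsupp (w := -Pi.single i 1)
        (fun k => by have := hei k; simp only [Pi.neg_apply]; constructor <;> omega) hb'
      refine ⟨fun k => by have := hbx k; constructor <;> omega, fun k => ?_⟩
      have := hbx k; have := single_add_single_apply_bounds hij k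
      constructor <;> omega
  have T2 : ∑ z ∈ Fintype.piFinset (fun _ : Fin 4 => Finset.Icc (-2 : ℤ) (N + 2)),
      u (z + Pi.single i 1, j) * u (z, i) =
      ∑ x ∈ Fintype.piFinset (fun _ : Fin 4 => Finset.Icc (-2 : ℤ) (N + 2)),
      u (x, j) * u (x - Pi.single i 1, i) := by
    have key := sum_shift_eq (a := -2) (b := (N : ℤ) + 2) (Pi.single i 1)
      (fun x => u (x, j) * u (x - Pi.single i 1, i)) ?_
    · refine Eq.trans (Finset.sum_congr rfl fun z _ => ?_) key
      have h1 : z + Pi.single i 1 - Pi.single i 1 = z := by abel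
      simp only [h1]
    · intro x hx
      obtain ⟨ha, hb⟩ := mul_ne_zero_iff.1 hx
      have hb' : u (x + (-Pi.single i 1), i) ≠ 0 := by rwa [← sub_eq_add_neg]
      have hbx := bounds_of_shift_ne_zero hsupp (w := -Pi.single i 1)
        (fun k => by have := hei k; simp only [Pi.neg_apply]; constructor <;> omega) hb'
      have hax := hsupp _ _ ha
      refine ⟨fun k => by have := hax k; constructor <;> omega, fun k => ?_⟩
      have := hbx k; have := hei k; have := hax k
      constructor <;> omega
  have T3 : ∑ z ∈ Fintype.piFinset (fun _ : Fin 4 => Finset.Icc (-2 : ℤ) (N + 2)),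
      u (z, j) * u (z + Pi.single j 1, i) =
      ∑ x ∈ Fintype.piFinset (fun _ : Fin 4 => Finset.Icc (-2 : ℤ) (N + 2)),
      u (x - Pi.single j 1, j) * u (x, i) := by
    have key := sum_shift_eq (a := -2) (b := (N : ℤ) + 2) (Pi.single j 1)
      (fun x => u (x - Pi.single j 1, j) * u (x, i)) ?_
    · refine Eq.trans (Finset.sum_congr rfl fun z _ => ?_) key
      have h1 : z + Pi.single j 1 - Pi.single j 1 = z := by abel
      simp only [h1]
    · intro x hx
      obtain ⟨ha, hb⟩ := mul_ne_zero_iff.1 hx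
      have ha' : u (x + (-Pi.single j 1), j) ≠ 0 := by rwa [← sub_eq_add_neg]
      have hax := bounds_of_shift_ne_zero hsupp (w := -Pi.single j 1)
        (fun k => by have := hej k; simp only [Pi.neg_apply]; constructor <;> omega) ha'
      have hbx := hsupp _ _ hb
      refine ⟨fun k => by have := hbx k; constructor <;> omega, fun k => ?_⟩
      have := hax k; have := hej k; have := hbx k
      constructor <;> omega
  have L : ∀ z : Fin 4 → ℤ, (u (z + Pi.single i 1, j) - u (z, j)) * (u (z + Pi.single j 1, i) - u (z, i)) =
      u (z + Pi.single i 1, j) * u (z + Pi.single j 1, i) - u (z + Pi.single i 1, j) * u (z, i)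
        - u (z, j) * u (z + Pi.single j 1, i) + u (z, j) * u (z, i) := fun z => by ring
  have R : ∀ x : Fin 4 → ℤ, (u (x, i) - u (x - Pi.single i 1, i)) * (u (x, j) - u (x - Pi.single j 1, j)) =
      u (x - Pi.single j 1, j) * u (x - Pi.single i 1, i) - u (x, j) * u (x - Pi.single i 1, i)
        - u (x - Pi.single j 1, j) * u (x, i) + u (x, j) * u (x, i) := fun x => by ring
  simp only [L, R, Finset.sum_add_distrib, Finset.sum_sub_distrib, T1, T2, T3]

/-- For a CORE edge function (every transverse coordinate of a charged edge in `[1, N−1]`) and `i ≠ j`, the product of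
backward differences `(u(x,i) − u(x−e_i,i))·(u(x,j) − u(x−e_j,j))` vanishes off the interior cube `[1, N−1]⁴`. -/
theorem cross_eq_zero_of_not_interior {N : ℕ} {u : (Fin 4 → ℤ) × Fin 4 → ℝ}
    (hcore : ∀ x i, u (x, i) ≠ 0 → ∀ k, k ≠ i → 1 ≤ x k ∧ x k + 1 ≤ N) {i j : Fin 4} (hij : i ≠ j)
    {x : Fin 4 → ℤ} (hx : ¬ ∀ k, 1 ≤ x k ∧ x k + 1 ≤ N) :
    (u (x, i) - u (x - Pi.single i 1, i)) * (u (x, j) - u (x - Pi.single j 1, j)) = 0 := by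
  obtain ⟨k, hk⟩ := not_forall.1 hx
  have vanish : ∀ l : Fin 4, l ≠ k → u (x, l) - u (x - Pi.single l 1, l) = 0 := by
    intro l hl
    have h1 : u (x, l) = 0 := by
      by_contra h
      have := hcore x l h k (Ne.symm hl)
      exact absurd this hk
    have h2 : u (x - Pi.single l 1, l) = 0 := by
      by_contra h
      have := hcore _ l h k (Ne.symm hl)
      simp only [Pi.sub_apply, Pi.single_eq_of_ne (Ne.symm hl), sub_zero] at this
      exact absurd this hk
    rw [h1, h2, sub_zero]
  by_cases hik : i = k
  · subst hik
    rw [vanish j (Ne.symm hij), mul_zero]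
  · rw [vanish i hik, zero_mul]

/-- Sum over ordered pairs `i ≠ j` of `c i j + c j i` versus the symmetric sum. -/
theorem sum_ne_add_swap (c : Fin 4 → Fin 4 → ℝ) :
    ∑ i : Fin 4, ∑ j : Fin 4, (if i ≠ j then c j i else 0) = ∑ i : Fin 4, ∑ j : Fin 4, (if i ≠ j then c i j else 0) := by
  rw [Finset.sum_comm]
  refine Finset.sum_congr rfl fun i _ => Finset.sum_congr rfl fun j _ => ?_
  by_cases h : i = j
  · subst h; simp
  · rw [if_pos (Ne.symm h), if_pos h]

/-- The sum over ordered pairs `i < j` of a symmetric quantity is half the sum over `i ≠ j`. -/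
theorem sum_lt_eq_sum_ne (c : Fin 4 → Fin 4 → ℝ) (hc : ∀ i j, c i j = c j i) :
    2 * ∑ i : Fin 4, ∑ j : Fin 4, (if i < j then c i j else 0) = ∑ i : Fin 4, ∑ j : Fin 4, (if i ≠ j then c i j else 0) := by
  have h1 : ∑ i : Fin 4, ∑ j : Fin 4, (if i ≠ j then c i j else 0) =
      ∑ i : Fin 4, ∑ j : Fin 4, ((if i < j then c i j else 0) + (if j < i then c i j else 0)) := by
    refine Finset.sum_congr rfl fun i _ => Finset.sum_congr rfl fun j _ => ?_
    rcases lt_trichotomy i j with h | h | h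
    · rw [if_pos h.ne, if_pos h, if_neg (not_lt.2 h.le), add_zero]
    · subst h; simp
    · rw [if_pos h.ne', if_neg (not_lt.2 h.le), if_pos h, zero_add]
  have h2 : ∑ i : Fin 4, ∑ j : Fin 4, (if j < i then c i j else 0) = ∑ i : Fin 4, ∑ j : Fin 4, (if i < j then c i j else 0) := by
    rw [Finset.sum_comm]
    exact Finset.sum_congr rfl fun i _ => Finset.sum_congr rfl fun j _ => by rw [hc]
  rw [h1]
  simp only [Finset.sum_add_distrib]
  rw [h2]; ring

/-- Square of a sum over `Fin 4`: diagonal plus off-diagonal part. -/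
theorem sq_sum_fin4 (a : Fin 4 → ℝ) :
    (∑ i : Fin 4, a i) ^ 2 = ∑ i : Fin 4, a i ^ 2 + ∑ i : Fin 4, ∑ j : Fin 4, (if i ≠ j then a i * a j else 0) := by
  rw [sq, Finset.sum_mul_sum, ← Finset.sum_add_distrib]
  refine Finset.sum_congr rfl fun i _ => ?_
  have hdiag : ∑ j : Fin 4, (if i = j then a i * a j else 0) = a i * a i := by
    rw [Finset.sum_ite_eq Finset.univ i (fun j => a i * a j)]; simp
  have hsplit : ∑ j : Fin 4, a i * a j =
      ∑ j : Fin 4, (if i = j then a i * a j else 0) + ∑ j : Fin 4, (if i ≠ j then a i * a j else 0) := by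
    rw [← Finset.sum_add_distrib]
    refine Finset.sum_congr rfl fun j _ => ?_
    by_cases h : i = j
    · rw [if_pos h, if_neg (not_not.2 h), add_zero]
    · rw [if_neg h, if_pos h, zero_add]
  rw [hsplit, hdiag, sq]

/-- **Energy of a core edge function** (parametrised form).  With `G i j = Σ_x (u(x+e_i,j) − u(x,j))²` (transverse Dirichlet
energies over the cube `[-2,N+2]⁴`) and `X i j = Σ_{x interior} D_i(x) D_j(x)` (products of backward differences over the interior
cube `[1,N−1]⁴`): for a CORE edge function, `Σ_{i≠j} G i j ≤ Σ_z Σ_{i<j} circ² + Σ_{x interior} div²`. -/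
theorem core_energy_aux (N : ℕ) (u : (Fin 4 → ℤ) × Fin 4 → ℝ)
    (hsupp : ∀ x i, u (x, i) ≠ 0 → ∀ k, 0 ≤ x k ∧ x k ≤ N)
    (hcore : ∀ x i, u (x, i) ≠ 0 → ∀ k, k ≠ i → 1 ≤ x k ∧ x k + 1 ≤ N)
    (G X : Fin 4 → Fin 4 → ℝ)
    (hG : ∀ i j, G i j = ∑ x ∈ Fintype.piFinset (fun _ : Fin 4 => Finset.Icc (-2 : ℤ) (N + 2)),
      (u (x + Pi.single i 1, j) - u (x, j)) ^ 2)
    (hX : ∀ i j, X i j = ∑ x ∈ Fintype.piFinset (fun _ : Fin 4 => Finset.Icc (1 : ℤ) (N - 1)),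
      (u (x, i) - u (x - Pi.single i 1, i)) * (u (x, j) - u (x - Pi.single j 1, j))) :
    ∑ i : Fin 4, ∑ j : Fin 4, (if i ≠ j then G i j else 0) ≤
      ∑ z ∈ Fintype.piFinset (fun _ : Fin 4 => Finset.Icc (-2 : ℤ) (N + 2)), ∑ i : Fin 4, ∑ j : Fin 4,
          (if i < j then (u (z, i) + u (z + Pi.single i 1, j) - u (z + Pi.single j 1, i) - u (z, j)) ^ 2 else 0) +
        ∑ x ∈ Fintype.piFinset (fun _ : Fin 4 => Finset.Icc (1 : ℤ) (N - 1)),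
          (∑ i : Fin 4, (u (x - Pi.single i 1, i) - u (x, i))) ^ 2 := by
  have hIB : Fintype.piFinset (fun _ : Fin 4 => Finset.Icc (1 : ℤ) (N - 1)) ⊆
      Fintype.piFinset (fun _ : Fin 4 => Finset.Icc (-2 : ℤ) (N + 2)) := by
    intro x hx
    rw [mem_box] at hx ⊢
    intro k; have := hx k; constructor <;> omega
  -- per ordered pair: the plaquette energy
  have pair : ∀ i j : Fin 4, i ≠ j →
      ∑ z ∈ Fintype.piFinset (fun _ : Fin 4 => Finset.Icc (-2 : ℤ) (N + 2)),
        (u (z, i) + u (z + Pi.single i 1, j) - u (z + Pi.single j 1, i) - u (z, j)) ^ 2 =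
        G i j + G j i - 2 * X i j := by
    intro i j hij
    have hXB : X i j = ∑ x ∈ Fintype.piFinset (fun _ : Fin 4 => Finset.Icc (-2 : ℤ) (N + 2)),
        (u (x, i) - u (x - Pi.single i 1, i)) * (u (x, j) - u (x - Pi.single j 1, j)) := by
      rw [hX]
      refine Finset.sum_subset hIB fun x _ hxI => ?_
      refine cross_eq_zero_of_not_interior hcore hij fun h => hxI ?_
      rw [mem_box]
      intro k; have := h k; constructor <;> omega
    have hcross := sum_cross_eq N u hsupp hij
    have expand : ∀ z : Fin 4 → ℤ, (u (z, i) + u (z + Pi.single i 1, j) - u (z + Pi.single j 1, i) - u (z, j)) ^ 2 =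
        (u (z + Pi.single i 1, j) - u (z, j)) ^ 2 + (u (z + Pi.single j 1, i) - u (z, i)) ^ 2
          - 2 * ((u (z + Pi.single i 1, j) - u (z, j)) * (u (z + Pi.single j 1, i) - u (z, i))) := fun z => by ring
    rw [Finset.sum_congr rfl fun z _ => expand z, Finset.sum_sub_distrib, Finset.sum_add_distrib, ← Finset.mul_sum,
      hcross, ← hXB, ← hG i j, ← hG j i]
  -- the plaquette sum in terms of G and X
  have hF : ∑ z ∈ Fintype.piFinset (fun _ : Fin 4 => Finset.Icc (-2 : ℤ) (N + 2)), ∑ i : Fin 4, ∑ j : Fin 4,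
      (if i < j then (u (z, i) + u (z + Pi.single i 1, j) - u (z + Pi.single j 1, i) - u (z, j)) ^ 2 else 0) =
      ∑ i : Fin 4, ∑ j : Fin 4, (if i < j then G i j + G j i - 2 * X i j else 0) := by
    rw [Finset.sum_comm]
    refine Finset.sum_congr rfl fun i _ => ?_
    rw [Finset.sum_comm]
    refine Finset.sum_congr rfl fun j _ => ?_
    by_cases hij : i < j
    · simp only [if_pos hij]
      exact pair i j hij.ne
    · simp only [if_neg hij, Finset.sum_const_zero]
  -- symmetrise: `i < j` sums are half the `i ≠ j` sums
  have hXsymm : ∀ i j, X i j = X j i := by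
    intro i j; rw [hX, hX]; exact Finset.sum_congr rfl fun x _ => by ring
  have hsymm : ∀ i j, G i j + G j i - 2 * X i j = G j i + G i j - 2 * X j i := by
    intro i j; rw [hXsymm]; ring
  have hF2 := sum_lt_eq_sum_ne (fun i j => G i j + G j i - 2 * X i j) hsymm
  have hGsum : ∑ i : Fin 4, ∑ j : Fin 4, (if i ≠ j then G i j + G j i - 2 * X i j else 0) =
      2 * ∑ i : Fin 4, ∑ j : Fin 4, (if i ≠ j then G i j else 0) -
        2 * ∑ i : Fin 4, ∑ j : Fin 4, (if i ≠ j then X i j else 0) := by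
    have h1 : ∑ i : Fin 4, ∑ j : Fin 4, (if i ≠ j then G i j + G j i - 2 * X i j else 0) =
        ∑ i : Fin 4, ∑ j : Fin 4, (if i ≠ j then G i j else 0) + ∑ i : Fin 4, ∑ j : Fin 4, (if i ≠ j then G j i else 0)
          - 2 * ∑ i : Fin 4, ∑ j : Fin 4, (if i ≠ j then X i j else 0) := by
      rw [Finset.mul_sum, ← Finset.sum_add_distrib, ← Finset.sum_sub_distrib]
      refine Finset.sum_congr rfl fun i _ => ?_
      rw [Finset.mul_sum, ← Finset.sum_add_distrib, ← Finset.sum_sub_distrib]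
      refine Finset.sum_congr rfl fun j _ => ?_
      by_cases h : i ≠ j
      · simp only [if_pos h]
      · simp only [if_neg h]; ring
    rw [h1, sum_ne_add_swap G]; ring
  -- the divergence sum in terms of X
  have hD : ∑ x ∈ Fintype.piFinset (fun _ : Fin 4 => Finset.Icc (1 : ℤ) (N - 1)),
      (∑ i : Fin 4, (u (x - Pi.single i 1, i) - u (x, i))) ^ 2 =
      ∑ x ∈ Fintype.piFinset (fun _ : Fin 4 => Finset.Icc (1 : ℤ) (N - 1)),
        ∑ i : Fin 4, (u (x - Pi.single i 1, i) - u (x, i)) ^ 2 +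
        ∑ i : Fin 4, ∑ j : Fin 4, (if i ≠ j then X i j else 0) := by
    have hsq : ∀ x : Fin 4 → ℤ, (∑ i : Fin 4, (u (x - Pi.single i 1, i) - u (x, i))) ^ 2 =
        ∑ i : Fin 4, (u (x - Pi.single i 1, i) - u (x, i)) ^ 2 +
          ∑ i : Fin 4, ∑ j : Fin 4, (if i ≠ j then
            (u (x - Pi.single i 1, i) - u (x, i)) * (u (x - Pi.single j 1, j) - u (x, j)) else 0) :=
      fun x => sq_sum_fin4 (fun i => u (x - Pi.single i 1, i) - u (x, i))
    have hcomm : ∑ x ∈ Fintype.piFinset (fun _ : Fin 4 => Finset.Icc (1 : ℤ) (N - 1)),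
        ∑ i : Fin 4, ∑ j : Fin 4, (if i ≠ j then
            (u (x - Pi.single i 1, i) - u (x, i)) * (u (x - Pi.single j 1, j) - u (x, j)) else 0) =
        ∑ i : Fin 4, ∑ j : Fin 4, (if i ≠ j then X i j else 0) := by
      rw [Finset.sum_comm]
      refine Finset.sum_congr rfl fun i _ => ?_
      rw [Finset.sum_comm]
      refine Finset.sum_congr rfl fun j _ => ?_
      by_cases h : i ≠ j
      · rw [if_pos h, hX i j]
        simp only [if_pos h]
        exact Finset.sum_congr rfl fun x _ => by ring
      · simp only [if_neg h, Finset.sum_const_zero]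
    rw [Finset.sum_congr rfl fun x _ => hsq x, Finset.sum_add_distrib, hcomm]
  have hpos : 0 ≤ ∑ x ∈ Fintype.piFinset (fun _ : Fin 4 => Finset.Icc (1 : ℤ) (N - 1)),
      ∑ i : Fin 4, (u (x - Pi.single i 1, i) - u (x, i)) ^ 2 :=
    Finset.sum_nonneg fun x _ => Finset.sum_nonneg fun i _ => sq_nonneg _
  rw [hF, hD]
  linarith

/-- **Energy of a core edge function.**  If `u` is supported on CORE box edges (base in `[0,N]⁴`, every transverse
coordinate of a charged edge in `[1, N−1]`), then the Maxwell-plus-gauge form bounds all transverse Dirichlet energies: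
`Σ_{i ≠ j} Σ_x (u(x+e_i, j) − u(x, j))² ≤ Σ_z Σ_{i<j} circ(z;i,j)² + Σ_{x interior} div(x)²`
(the boundary cross terms of the lattice div–curl identity vanish identically for core fields). -/
theorem core_energy (N : ℕ) (u : (Fin 4 → ℤ) × Fin 4 → ℝ)
    (hsupp : ∀ x i, u (x, i) ≠ 0 → ∀ k, 0 ≤ x k ∧ x k ≤ N)
    (hcore : ∀ x i, u (x, i) ≠ 0 → ∀ k, k ≠ i → 1 ≤ x k ∧ x k + 1 ≤ N) :
    ∑ i : Fin 4, ∑ j : Fin 4, (if i ≠ j then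
        ∑ x ∈ Fintype.piFinset (fun _ : Fin 4 => Finset.Icc (-2 : ℤ) (N + 2)), (u (x + Pi.single i 1, j) - u (x, j)) ^ 2 else 0) ≤
      ∑ z ∈ Fintype.piFinset (fun _ : Fin 4 => Finset.Icc (-2 : ℤ) (N + 2)), ∑ i : Fin 4, ∑ j : Fin 4,
          (if i < j then (u (z, i) + u (z + Pi.single i 1, j) - u (z + Pi.single j 1, i) - u (z, j)) ^ 2 else 0) +
        ∑ x ∈ Fintype.piFinset (fun _ : Fin 4 => Finset.Icc (1 : ℤ) (N - 1)),
          (∑ i : Fin 4, (u (x - Pi.single i 1, i) - u (x, i))) ^ 2 :=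
  core_energy_aux N u hsupp hcore _ _ (fun _ _ => rfl) (fun _ _ => rfl)

end Summit.QuantumFields.YangMills.Theorems.AllWindowsColdBoxBoxHighLine.HodgePoincare
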